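import Summits.RiemannHypothesis.RiemannHypothesis.Theorems.SemilocalPiecewiseCert
import HarnessLib

/-!
# Semi-local thresholds, negative side (IVe): the piecewise certificate with PER-PIECE enclosure orders (`WeilNegCertPW`, flexible far pieces)

Cell `rh-explicit` (HOME `run/shared/lean/pub/rh-explicit/`), seat cc-s2-4 gen12 (kernel column of the A4 SEMILOCAL-TABLE; log of record
`HOME/cc-s2-4/CC4-LEAN.md` §17).  Honest framing: bookkeeping for negative certificates about the tree's `weilSemilocalThreshold S`;
nothing here bears on RH.  No data is trusted.

WHY (numbers, CC4-LEAN §16.5–16.7, §17.2).  In the kinked rows (`SemilocalNegCertUpto{NinetySeven,HundredThree,HundredThirtyOne}Kinked*`,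
twin-prime walls `q = 101, 107, 137`) every far `t`-piece is checked by `WeilNegCertPW.checkPiecePW i`, i.e. by
`pieceFarQ c.nA c.mA c.KA c.mF Dᵢ T₀ T₁` with the certificate's GLOBAL orders `(10, 4, 8, 4)` and the majorant centred at the EXACT
rational `u₀ = u_K(T₀)` (a 60-digit fraction whose ninth power sits in every coefficient of the degree-184 majorant).  Measured on the
farm (piece 120 of the `q = 101` row, `t ∈ [0.788, 0.802]`): 36 s per fact, of which ≈ 5 s is the increment `Dᵢ` itself; with a SHORT
dyadic centre `u₀ ≤ u_K(T₀)` and the orders `(8, 1, 4, 2)` that a piece of width `0.014` actually needs the same fact costs ≈ 7 s and the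
bound moves by `1.3·10⁻⁸` relative; a far piece (`t ≈ 3.4`, width `0.21`) needs `(8, 4, 8, 3)` (`6.5·10⁻⁹` relative; `(8,1,4,2)` would
lose `2.5·10⁻³`) and drops from 25 s to 12 s.  This file makes the orders and the centre PER-PIECE DATA:

* `pieceFarQU n m K m' u₀ D T₀ T₁` — `pieceFarQ` with the centre `u₀` supplied; THEOREM B⁗-U
  `setIntegral_weilArchDensity_mul_le_pieceFarU`: for `0 < T₀ < T₁ ≤ 8`, `D ≥ 0` agreeing with the increment on `(T₀, T₁]`,
  `0 < n`, `0 ≤ u₀ ≤ u_K(T₀)` (the last as the decidable `u₀ ≤ evQ (uSumL K) T₀`): `∫_{(T₀,T₁]} w·D ≤ pieceFarQU …`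
  (the proof of B⁗ verbatim with the centre generalised — `weilArchDensity_le_far` only needs `u₀ ≤ u_K(t)` on the piece);
* `WeilNegCertPW.PieceOrd`, `WeilNegCertPW.checkPieceFlex c i o` — the kernel fact for a far piece `i ≥ 1` with orders/centre `o`
  (checks `0 < i`, `0 < o.n`, `0 ≤ o.u0 ≤ u_{o.K}(T₀ i)` and `pieceFarQU … ≤ Bᵢ`);
* `WeilNegCertPW.checkPiecesFlexFrom c i os` — a run of such facts (one `decide` for several consecutive light pieces) and
  `WeilNegCertPW.exists_checkPieceFlex_of_from` (a run fact gives the per-piece facts);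
* SOUNDNESS `weilSemilocalThreshold_le_of_checkPW_flex[_sharp]`: as `…_of_checkPW[_sharp]` but each piece may be discharged EITHER by
  `checkPiecePW i` (piece `0` always is) OR by some `checkPieceFlex i o` — the tree's proof verbatim with one more case in the piece block.

Folklore throughout.
-/

set_option autoImplicit false
set_option linter.dupNamespace false  -- the mandated namespace repeats `RiemannHypothesis`

noncomputable section

open Complex Filter Set MeasureTheory Topology
open scoped Real

namespace Summit.RiemannHypothesis.RiemannHypothesis.Theorems.SemilocalPolyWitness

open MeasureTheory Set Finset Real
open Literature.NumberTheory.LFunctions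
open Summit.RiemannHypothesis.RiemannHypothesis.Theorems.MotivicDoor
open Summit.RiemannHypothesis.RiemannHypothesis.Theorems.MotivicDoor.SemilocalThreshold
open Summit.RiemannHypothesis.RiemannHypothesis.Theorems.MotivicDoor.SemilocalMarkov
open LQ

/-! ## THEOREM B⁗-U: the far-piece bound with a supplied centre -/

/-- The rational far-piece bound with the majorant centred at a SUPPLIED `u₀` (any rational `0 ≤ u₀ ≤ u_K(T₀)`; `pieceFarQ` is the
case `u₀ = evQ (uSumL K) T₀`). -/
def pieceFarQU (n m K m' : ℕ) (u0 : ℚ) (D : List ℚ) (T0 T1 : ℚ) : ℚ :=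
  evQ (integ (mul (archMajorFarL n m K u0 m' T0) D)) T1 -
    evQ (integ (mul (archMajorFarL n m K u0 m' T0) D)) T0

/-- **THEOREM B⁗-U.**  Let `0 < T₀ < T₁ ≤ 8` be rationals and let the increment `Dfun` agree on `(T₀, T₁]` with the list
polynomial `D`, non-negative there; let `0 < n` and `0 ≤ u₀ ≤ u_K(T₀)`.  Then `w·Dfun` is integrable on `(T₀, T₁]` and
`∫_{(T₀,T₁]} w·Dfun ≤ pieceFarQU n m K m' u₀ D T₀ T₁`. -/
theorem setIntegral_weilArchDensity_mul_le_pieceFarU {D : List ℚ} {Dfun : ℝ → ℝ} {T0 T1 : ℚ} (hT0 : 0 < T0)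
    (hT01 : T0 < T1) (hT8 : (T1 : ℝ) ≤ 8)
    (hD : ∀ t ∈ Ioc (T0 : ℝ) T1, Dfun t = ev D t) (hDnn : ∀ t ∈ Ioc (T0 : ℝ) T1, 0 ≤ ev D t)
    (n m K m' : ℕ) (hn : 0 < n) {u0 : ℚ} (hu0 : 0 ≤ u0) (hu0le : u0 ≤ evQ (uSumL K) T0) :
    IntegrableOn (fun t ↦ weilArchDensity t * Dfun t) (Ioc (T0 : ℝ) T1) ∧
      ∫ t in Ioc (T0 : ℝ) T1, weilArchDensity t * Dfun t ≤ ((pieceFarQU n m K m' u0 D T0 T1 : ℚ) : ℝ) := by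
  have hT0' : (0 : ℝ) < T0 := by exact_mod_cast hT0
  have hT01' : (T0 : ℝ) < T1 := by exact_mod_cast hT01
  have hu0R : (u0 : ℝ) ≤ uSum K T0 := by
    have h : ((u0 : ℚ) : ℝ) ≤ ((evQ (uSumL K) T0 : ℚ) : ℝ) := by exact_mod_cast hu0le
    rwa [← ev_ratCast, ev_uSumL] at h
  set Mj : ℝ → ℝ := fun t ↦ ev (mul (archMajorFarL n m K u0 m' T0) D) t with hM
  set P : ℝ → ℝ := fun t ↦ weilArchDensity t * ev D t with hP
  have hMc : Continuous Mj := continuous_ev _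
  have hMi : IntegrableOn Mj (Ioc (T0 : ℝ) T1) :=
    (hMc.integrableOn_Icc (a := (T0 : ℝ)) (b := (T1 : ℝ))).mono_set Ioc_subset_Icc_self
  have hEq : EqOn (fun t ↦ weilArchDensity t * Dfun t) P (Ioc (T0 : ℝ) T1) := fun t ht ↦ by
    simp only [hP, hD t ht]
  have hpt : ∀ t ∈ Ioc (T0 : ℝ) T1, 0 ≤ P t ∧ P t ≤ Mj t := by
    intro t ht
    have ht0 : 0 < t := lt_trans hT0' ht.1
    have hw := weilArchDensity_pos ht0
    have hqt := hDnn t ht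
    refine ⟨mul_nonneg hw.le hqt, ?_⟩
    rw [hM, hP]
    simp only
    rw [ev_mul]
    refine mul_le_mul_of_nonneg_right ?_ hqt
    refine weilArchDensity_le_far n m K hn hu0 m' hT0 ht.1.le (ht.2.trans hT8) ?_
    exact hu0R.trans (uSum_mono K hT0'.le ht.1.le)
  have hPm : AEStronglyMeasurable P (volume.restrict (Ioc (T0 : ℝ) T1)) := by
    have : Measurable P := by
      rw [hP]
      exact measurable_weilArchDensity.mul (continuous_ev D).measurable
    exact this.aestronglyMeasurable
  have hPint : IntegrableOn P (Ioc (T0 : ℝ) T1) := by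
    refine Integrable.mono' hMi hPm ?_
    filter_upwards [ae_restrict_mem measurableSet_Ioc] with t ht
    rw [Real.norm_eq_abs, abs_of_nonneg (hpt t ht).1]
    exact (hpt t ht).2
  have hint : IntegrableOn (fun t ↦ weilArchDensity t * Dfun t) (Ioc (T0 : ℝ) T1) :=
    hPint.congr_fun hEq.symm measurableSet_Ioc
  refine ⟨hint, ?_⟩
  calc ∫ t in Ioc (T0 : ℝ) T1, weilArchDensity t * Dfun t
      = ∫ t in Ioc (T0 : ℝ) T1, P t := setIntegral_congr_fun measurableSet_Ioc hEq
    _ ≤ ∫ t in Ioc (T0 : ℝ) T1, Mj t := setIntegral_mono_on hPint hMi measurableSet_Ioc fun t ht ↦ (hpt t ht).2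
    _ = ∫ t in (T0 : ℝ)..T1, Mj t := (intervalIntegral.integral_of_le hT01'.le).symm
    _ = ((pieceFarQU n m K m' u0 D T0 T1 : ℚ) : ℝ) := by
        rw [hM, integral_ev, pieceFarQU, ev_ratCast, ev_ratCast]
        push_cast
        rfl

/-! ## The flexible piece check -/

namespace WeilNegCertPW

/-- Per-piece enclosure data for a far piece: orders `(n, m, K, m')` of the `exp` majorant, the geometric majorant, the `sinh`
minorant and the `1/t` majorant, and the centre `u₀` (a short rational `≤ u_K(T₀)`). -/
structure PieceOrd where
  /-- order of the `exp` majorant (`≥ 1`) -/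
  n : ℕ
  /-- half the number of geometric terms in the centred majorant -/
  m : ℕ
  /-- order of the `sinh` minorant -/
  K : ℕ
  /-- half the number of geometric terms in the `1/t` majorant -/
  m' : ℕ
  /-- the centre, a rational lower bound of `u_K(T₀)` -/
  u0 : ℚ

variable (c : WeilNegCertPW)

/-- Flexible kernel fact for a far piece `i ≥ 1`: with the orders and centre `o`, the `i`-th piece integral is at most the
claimed `B_i`. -/
def checkPieceFlex (i : ℕ) (o : PieceOrd) : Bool :=
  match c.D i with
  | none => false
  | some Di =>
      decide (0 < i) && decide (0 < o.n) && decide (0 ≤ o.u0) && decide (o.u0 ≤ evQ (uSumL o.K) (c.T0 i)) &&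
        decide (pieceFarQU o.n o.m o.K o.m' o.u0 Di (c.T0 i) (c.T1 i) ≤ c.pieceB.getD i 0)

/-- A run of flexible facts for the consecutive pieces `i, i+1, …, i + os.length − 1`. -/
def checkPiecesFlexFrom : ℕ → List PieceOrd → Bool
  | _, [] => true
  | i, o :: os => c.checkPieceFlex i o && checkPiecesFlexFrom (i + 1) os

/-- A run fact yields the per-piece facts. -/
theorem exists_checkPieceFlex_of_from : ∀ (i : ℕ) (os : List PieceOrd), c.checkPiecesFlexFrom i os = true →
    ∀ j, i ≤ j → j < i + os.length → ∃ o, c.checkPieceFlex j o = true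
  | i, [], _, j, hij, hj => by simp at hj; omega
  | i, o :: os, h, j, hij, hj => by
      simp only [checkPiecesFlexFrom, Bool.and_eq_true] at h
      rcases Nat.eq_or_lt_of_le hij with rfl | hlt
      · exact ⟨o, h.1⟩
      · exact exists_checkPieceFlex_of_from (i + 1) os h.2 j hlt (by simp only [List.length_cons] at hj; omega)

end WeilNegCertPW

/-! ## Soundness with flexible pieces -/

/-- **SOUNDNESS of the piecewise certificate, flexible far pieces**: as `weilSemilocalThreshold_le_of_checkPW`, but each piece may be
discharged either by `checkPiecePW i` or by some `checkPieceFlex i o`. -/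
theorem weilSemilocalThreshold_le_of_checkPW_flex (c : WeilNegCertPW) {S : Finset ℕ} {N : ℕ} {c0 : ℚ}
    (henc : AtomsEnclose S N c.atoms c.logSuccLo) (hc0 : (c0 : ℝ) ≤ semilocalEmptyConstant)
    (hmain : c.checkMainPW c0 = true) (hat : c.checkAtomsPW = true)
    (hpieces : ∀ i, i < c.cuts.length → c.checkPiecePW i = true ∨ ∃ o, c.checkPieceFlex i o = true) :
    weilSemilocalThreshold S ≤ (c.b : ℝ) := by
  simp only [WeilNegCertPW.checkMainPW, Bool.and_eq_true, decide_eq_true_eq] at hmain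
  obtain ⟨⟨⟨⟨⟨⟨⟨⟨⟨⟨⟨⟨hin, hdisj⟩, hb0⟩, hb4⟩, hnA⟩, hnt⟩, htail1⟩, hatoms⟩, hsucc⟩, hcuts⟩, hlast⟩, hlen⟩,
    hfinal⟩ := hmain
  rw [atomsOk_iff] at hatoms
  obtain ⟨hnodup, hsub, hcover, hencl, hlogSucc⟩ := henc
  set b := c.b
  have hb0' : (0 : ℝ) < b := by exact_mod_cast hb0
  have hbwin : (b : ℝ) < Real.log ((N : ℝ) + 1) / 2 := by
    have h1 : ((2 * b : ℚ) : ℝ) < c.logSuccLo := by exact_mod_cast hsucc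
    push_cast at h1
    linarith
  set G := pwWitness c.P with hG
  have hW := isMarkovWitness_pwWitness hin hb0
  set Nm : ℝ := 2 * (pwNormSqF c.P : ℝ)
  have hN : ∫ x, ‖G x‖ ^ 2 = Nm := integral_norm_sq_pwWitness hin hdisj
  have hN0 : 0 ≤ Nm := by rw [← hN]; exact integral_nonneg fun x ↦ by positivity
  -- D on the pieces
  have hT0nn : ∀ k, 0 ≤ c.T0 k := by
    intro k
    cases k with
    | zero => simp [WeilNegCertPW.T0]
    | succ k =>
        simp only [WeilNegCertPW.T0, List.getD_cons_succ]
        by_cases hk : k < c.cuts.length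
        · exact (cutsOk_lt_getD 0 c.cuts hcuts k hk).le
        · rw [List.getD_eq_default _ _ (not_lt.1 hk)]
  have hDev : ∀ (k : ℕ) (Dk : List ℚ), c.D k = some Dk → ∀ t ∈ Icc ((c.T0 k : ℚ) : ℝ) (c.T1 k),
      weilIncrement G t = ev Dk t := fun k Dk hk t ht ↦
    weilIncrement_pwWitness_eq hin hdisj hb0 hk (hT0nn k) ht
  -- atoms
  have hAt : semilocalAtomEnergy S N G ≤ (c.atomB : ℝ) := by
    unfold semilocalAtomEnergy
    rw [sum_range_eq_atoms_sum (h := fun n ↦ weilSemilocalCoeff S n * weilIncrement G (Real.log n)) hnodup hsub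
      (fun n hn hnot ↦ by rw [hcover n hn hnot, zero_mul])]
    simp only [WeilNegCertPW.checkAtomsPW] at hat
    cases hA : c.atomLhsPW c.atoms c.atomPiece with
    | none => simp [hA] at hat
    | some A =>
      simp only [hA, decide_eq_true_eq] at hat
      refine (atoms_sum_le_atomLhsPW c hDev c.atoms c.atomPiece A hA (fun na hna ↦ (hencl na hna).2.2.2)
        (fun na hna ↦ ⟨(hencl na hna).1, (hencl na hna).2.1⟩)).trans (by exact_mod_cast hat)
  -- each piece
  have h8 : ∀ i, i < c.cuts.length → ((c.T1 i : ℚ) : ℝ) ≤ 8 := by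
    intro i hi
    have hle : c.T1 i ≤ lastCut 0 c.cuts := cutsOk_getD_le_lastCut 0 c.cuts hcuts i hi
    rw [hlast] at hle
    have : ((c.T1 i : ℚ) : ℝ) ≤ ((2 * b : ℚ) : ℝ) := by exact_mod_cast hle
    push_cast at this
    have hb4' : (b : ℝ) ≤ 4 := by exact_mod_cast hb4
    linarith
  have hT01 : ∀ i, i < c.cuts.length → c.T0 i < c.T1 i := fun i hi ↦ cutsOk_cons_getD_lt 0 c.cuts hcuts i hi
  have hpiece : ∀ i, i < c.cuts.length →
      IntegrableOn (fun t ↦ weilArchDensity t * weilIncrement G t) (Ioc ((c.T0 i : ℚ) : ℝ) (c.T1 i)) ∧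
        ∫ t in Ioc ((c.T0 i : ℚ) : ℝ) (c.T1 i), weilArchDensity t * weilIncrement G t ≤ (c.pieceB.getD i 0 : ℝ) := by
    intro i hi
    rcases hpieces i hi with hci | ⟨o, hco⟩
    · -- a piece checked with the certificate's global orders (the tree's case)
      simp only [WeilNegCertPW.checkPiecePW] at hci
      cases hDi : c.D i with
      | none => simp [hDi] at hci
      | some Di =>
        simp only [hDi] at hci
        have hDI : ∀ t ∈ Ioc ((c.T0 i : ℚ) : ℝ) (c.T1 i), weilIncrement G t = ev Di t := fun t ht ↦
          hDev i Di hDi t ⟨ht.1.le, ht.2⟩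
        have hnn : ∀ t ∈ Ioc ((c.T0 i : ℚ) : ℝ) (c.T1 i), 0 ≤ ev Di t := fun t ht ↦ by
          rw [← hDI t ht]; exact weilIncrement_nonneg G t
        split_ifs at hci with hi0
        · -- the first piece: D₀ = t·q₀, centred wide majorant
          simp only [Bool.and_eq_true, decide_eq_true_eq] at hci
          obtain ⟨hhead, hB⟩ := hci
          subst hi0
          have hT00 : c.T0 0 = 0 := by simp [WeilNegCertPW.T0]
          rw [hT00] at hDI hnn ⊢
          have hDq : ∀ t ∈ Ioc ((0 : ℚ) : ℝ) (c.T1 0), weilIncrement G t = t * ev Di.tail t := fun t ht ↦ by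
            rw [hDI t ht, ev_eq_headD_add_tail, hhead]; push_cast; ring
          have hq : ∀ t ∈ Ioc ((0 : ℚ) : ℝ) (c.T1 0), 0 ≤ ev Di.tail t := fun t ht ↦ by
            have h1 := weilIncrement_nonneg G t
            rw [hDq t ht] at h1
            have ht0 : (0 : ℝ) < t := by exact_mod_cast ht.1
            exact (mul_nonneg_iff_of_pos_left ht0).1 h1
          have h01 : (0 : ℚ) < c.T1 0 := by have := hT01 0 hi; rwa [hT00] at this
          have hres := setIntegral_weilArchDensity_mul_le_pieceW (q := Di.tail) (D := weilIncrement G) le_rfl h01 (h8 0 hi)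
            (fun t ht ↦ hDq t (by exact_mod_cast ht)) (fun t ht ↦ hq t (by exact_mod_cast ht)) c.nA c.mA c.KA hnA
          push_cast at hres ⊢
          exact ⟨hres.1, hres.2.trans (by exact_mod_cast hB)⟩
        · -- a far piece
          simp only [decide_eq_true_eq] at hci
          have hT0pos : 0 < c.T0 i := by
            cases i with
            | zero => exact absurd rfl hi0
            | succ i =>
                simp only [WeilNegCertPW.T0, List.getD_cons_succ]
                have := hT01 i (by omega)
                have h0 := hT0nn i
                exact lt_of_le_of_lt h0 this
          have hres := setIntegral_weilArchDensity_mul_le_pieceFar (D := Di) (Dfun := weilIncrement G) hT0pos (hT01 i hi)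
            (h8 i hi) hDI hnn c.nA c.mA c.KA c.mF hnA
          exact ⟨hres.1, hres.2.trans (by exact_mod_cast hci)⟩
    · -- a far piece checked with its own orders and centre (`checkPieceFlex`)
      simp only [WeilNegCertPW.checkPieceFlex] at hco
      cases hDi : c.D i with
      | none => simp [hDi] at hco
      | some Di =>
        simp only [hDi, Bool.and_eq_true, decide_eq_true_eq] at hco
        obtain ⟨⟨⟨⟨hi0, hn⟩, hu0⟩, hu0le⟩, hB⟩ := hco
        have hDI : ∀ t ∈ Ioc ((c.T0 i : ℚ) : ℝ) (c.T1 i), weilIncrement G t = ev Di t := fun t ht ↦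
          hDev i Di hDi t ⟨ht.1.le, ht.2⟩
        have hnn : ∀ t ∈ Ioc ((c.T0 i : ℚ) : ℝ) (c.T1 i), 0 ≤ ev Di t := fun t ht ↦ by
          rw [← hDI t ht]; exact weilIncrement_nonneg G t
        have hT0pos : 0 < c.T0 i := by
          cases i with
          | zero => exact absurd hi0 (lt_irrefl 0)
          | succ i =>
              simp only [WeilNegCertPW.T0, List.getD_cons_succ]
              have := hT01 i (by omega)
              have h0 := hT0nn i
              exact lt_of_le_of_lt h0 this
        have hres := setIntegral_weilArchDensity_mul_le_pieceFarU (D := Di) (Dfun := weilIncrement G) hT0pos (hT01 i hi)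
          (h8 i hi) hDI hnn o.n o.m o.K o.m' hn hu0 hu0le
        exact ⟨hres.1, hres.2.trans (by exact_mod_cast hB)⟩
  -- bulk over all pieces
  have hbulk := piecesPW_bound c hDev hpiece 0 0 c.cuts c.pieceB (fun j hj ↦ by
    simp [WeilNegCertPW.T0, WeilNegCertPW.T1, hj]) hcuts hlen
  have hlastR : ((lastCut 0 c.cuts : ℚ) : ℝ) = ((2 * b : ℚ) : ℝ) := by rw [hlast]
  rw [show ((0 : ℚ) : ℝ) = 0 by norm_num, hlastR] at hbulk
  push_cast at hbulk
  obtain ⟨hintA, hA⟩ := hbulk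
  have hintA' : IntegrableOn (fun t ↦ weilArchDensity t * weilIncrement G t) (Set.Ioc (0 : ℝ) ((2 * b : ℚ) : ℝ)) := by
    push_cast; exact hintA
  -- tail
  have h2b0 : (0 : ℚ) < 2 * b := by positivity
  obtain ⟨hintW, _⟩ := setIntegral_Ioi_weilArchDensity_le c.Kt (c := ((2 * b : ℚ) : ℝ)) (by exact_mod_cast h2b0)
  have hT := setIntegral_Ioi_weilArchDensity_le_archTailQ c.Kt hnt h2b0 htail1
  have hDtail : EqOn (fun t ↦ weilArchDensity t * weilIncrement G t) (fun t ↦ 2 * Nm * weilArchDensity t)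
      (Set.Ioi ((2 * b : ℚ) : ℝ)) := fun t ht ↦ by
    simp only
    rw [weilIncrement_pwWitness_eq_of_lt hin hdisj hb0 (by push_cast at ht; exact ht)]
    ring
  have hintW' : IntegrableOn (fun t ↦ 2 * Nm * weilArchDensity t) (Set.Ioi ((2 * b : ℚ) : ℝ)) :=
    hintW.const_mul (2 * Nm)
  have hintT : IntegrableOn (fun t ↦ weilArchDensity t * weilIncrement G t) (Set.Ioi ((2 * b : ℚ) : ℝ)) :=
    hintW'.congr_fun hDtail.symm measurableSet_Ioi
  have hTail : ∫ t in Set.Ioi ((2 * b : ℚ) : ℝ), weilArchDensity t * weilIncrement G t ≤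
      2 * Nm * archTailQ (2 * b) c.Kt c.nt := by
    rw [setIntegral_congr_fun measurableSet_Ioi hDtail, integral_const_mul]
    exact mul_le_mul_of_nonneg_left hT (by positivity)
  have hunion : Set.Ioc (0 : ℝ) ((2 * b : ℚ) : ℝ) ∪ Set.Ioi ((2 * b : ℚ) : ℝ) = Set.Ioi (0 : ℝ) :=
    Set.Ioc_union_Ioi_eq_Ioi (by exact_mod_cast h2b0.le)
  have hfin : IntegrableOn (fun t ↦ weilArchDensity t * weilIncrement G t) (Set.Ioi (0 : ℝ)) := by
    rw [← hunion]; exact hintA'.union hintT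
  have hInt : ∫ t in Set.Ioi (0 : ℝ), weilArchDensity t * weilIncrement G t
      ≤ (sumQ c.pieceB : ℝ) + 2 * Nm * archTailQ (2 * b) c.Kt c.nt := by
    rw [← hunion, setIntegral_union Ioc_disjoint_Ioi_same measurableSet_Ioi hintA' hintT]
    refine add_le_add ?_ hTail
    push_cast; exact hA
  have hpol : (0 : ℝ) ≤ ‖weilMellin G 1‖ ^ 2 := by positivity
  have hCS : (c0 : ℝ) + 2 * atomWloSum c.atoms ≤ semilocalWindowConstant S N := by
    unfold semilocalWindowConstant semilocalCoeffSum
    rw [sum_range_eq_atoms_sum (h := fun n ↦ weilSemilocalCoeff S n) hnodup hsub hcover]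
    have hw := atomWloSum_le c.atoms (fun na hna ↦ (hencl na hna).2.2.1)
    linarith
  have hfinal' : ((c.atomB + sumQ c.pieceB + 2 * (2 * c.NF) * archTailQ (2 * b) c.Kt c.nt : ℚ) : ℝ) <
      c.rhsPW c0 := by exact_mod_cast hfinal
  simp only [WeilNegCertPW.rhsPW, WeilNegCertPW.NF] at hfinal'
  push_cast at hfinal'
  have hrhs : ((c0 : ℝ) + 2 * atomWloSum c.atoms) * Nm ≤ semilocalWindowConstant S N * (∫ x, ‖G x‖ ^ 2) + 2 * ‖weilMellin G 1‖ ^ 2 := by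
    rw [hN]
    have : ((c0 : ℝ) + 2 * atomWloSum c.atoms) * Nm ≤ semilocalWindowConstant S N * Nm :=
      mul_le_mul_of_nonneg_right hCS hN0
    linarith
  have hlt : semilocalAtomEnergy S N G + (∫ t in Set.Ioi (0 : ℝ), weilArchDensity t * weilIncrement G t) <
      semilocalWindowConstant S N * (∫ x, ‖G x‖ ^ 2) + 2 * ‖weilMellin G 1‖ ^ 2 := by
    have : (c.atomB : ℝ) + ((sumQ c.pieceB : ℝ) + 2 * Nm * archTailQ (2 * b) c.Kt c.nt) <
        ((c0 : ℝ) + 2 * atomWloSum c.atoms) * Nm := by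
      simp only [Nm]; linarith
    linarith
  exact weilSemilocalThreshold_le_of_markovWitness_window S N hW hfin hlt hbwin

/-- Soundness with flexible far pieces and the sharp constant `c0SharpQ`. -/
theorem weilSemilocalThreshold_le_of_checkPW_flex_sharp (c : WeilNegCertPW) {S : Finset ℕ} {N : ℕ}
    (henc : AtomsEnclose S N c.atoms c.logSuccLo) (hmain : c.checkMainPW c0SharpQ = true)
    (hat : c.checkAtomsPW = true)
    (hpieces : ∀ i, i < c.cuts.length → c.checkPiecePW i = true ∨ ∃ o, c.checkPieceFlex i o = true) :
    weilSemilocalThreshold S ≤ (c.b : ℝ) :=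
  weilSemilocalThreshold_le_of_checkPW_flex c henc c0SharpQ_le hmain hat hpieces

/-- The old hypothesis implies the new one: a certificate all of whose pieces pass `checkPiecePW` passes the flexible check. -/
theorem weilSemilocalThreshold_le_of_checkPW_sharp' (c : WeilNegCertPW) {S : Finset ℕ} {N : ℕ}
    (henc : AtomsEnclose S N c.atoms c.logSuccLo) (hmain : c.checkMainPW c0SharpQ = true)
    (hat : c.checkAtomsPW = true) (hpieces : ∀ i, i < c.cuts.length → c.checkPiecePW i = true) :
    weilSemilocalThreshold S ≤ (c.b : ℝ) :=
  weilSemilocalThreshold_le_of_checkPW_flex_sharp c henc hmain hat fun i hi ↦ Or.inl (hpieces i hi)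

/-! ## Kernel regression -/

/-- Sanity (kernel): on the far piece `[1, 6/5]` with `D = [1]` the flexible bound with the short centre `u₀ = 87/512 ≤ u_5(1)` and
orders `(8, 2, 5, 3)` is finite and below `1/5` (the integral `∫_1^{1.2} w ≈ 0.117`). -/
example : pieceFarQU 8 2 5 3 (87 / 512) [1] 1 (6 / 5) < 1 / 5 := by
  decide +kernel

/-- Sanity (kernel): `87/512 ≤ u_5(1) = Σ_{k<5} 1/(2k+3)!`. -/
example : (87 / 512 : ℚ) ≤ evQ (uSumL 5) 1 := by
  decide +kernel

end Summit.RiemannHypothesis.RiemannHypothesis.Theorems.SemilocalPolyWitness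

end
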